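import Literature.Geometry.Riemannian.ThreeShrinkerSphericalCase
import Literature.Geometry.Riemannian.EinsteinThreeConstantCurvature
import HarnessLib

/-!
# The Einstein case of the classification of three-dimensional gradient shrinkers:
# disjunct (a) of the model data for compact Einstein members

Sixth companion of `ThreeShrinkerClassification.lean` (named fact
`Literature.Geometry.Riemannian.threeShrinkerClassification_modelData`, Munteanu–Wang
arXiv:1606.01861, Thm. 1.2). `ThreeShrinkerSphericalCase.lean` proves disjunct (a) of the fact
for compact members of its binder of constant sectional curvature; `EinsteinThreeConstantCurvature`
proves that an Einstein metric `Ric = λ h` on a `3`-manifold has constant sectional curvature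
`λ/2` (Lee 2018, Problem 8-14). Together: **disjunct (a) holds for every compact member of the
binder which is Einstein** (`modelData_a_of_ricci_eq_smul`), in particular for every compact member
whose potential has vanishing Hessian (`modelData_a_of_hessian_eq_zero`: then `Ric = ½ h`) or is
constant (`modelData_a_of_potential_eq_const`). This is the form in which the compact half of the
classification is concluded in print: a compact three-dimensional shrinking soliton is Einstein
(Ivey 1993, Thm. 1, via the Hamilton–Ivey pinching estimate; Eminenti–La Nave–Mantegazza 2008 by
the elliptic maximum principle), "hence of constant curvature since `n = 3`", hence `S³(2)/Γ` with
`R ≡ φ ≡ 3/2` and `Vol = 16π²/|Γ|`. Everything is proved; no definitions, no named facts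
(D-0026). What is NOT here: the theorem that compact three-dimensional shrinkers are Einstein.

## References

* O. Munteanu, J. Wang, *Structure at infinity for shrinking Ricci solitons*, arXiv:1606.01861,
  Thm. 1.2 (p. 3); proof of Thm. 5.1 (p. 21). [MunteanuWang2016]
* T. Ivey, *Ricci solitons on compact three-manifolds*, Diff. Geom. Appl. 3 (1993), Thm. 1.
  [Ivey1993]
* J. M. Lee, *Introduction to Riemannian Manifolds*, 2nd ed. (2018), Problem 8-14. [Lee2018]
* J. A. Carrillo, L. Ni, Comm. Anal. Geom. 17 (2009), Rem. 4.2 (constant potential: Einstein with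
  `Ric = ½ g`). [CarrilloNi2009]
-/

noncomputable section

open Bundle Set Function Filter Module MeasureTheory Metric
open scoped Manifold ContDiff Topology ENNReal NNReal

namespace Literature.Geometry.Riemannian

open Lorentzian Lorentzian.PseudoRiemannianMetric

namespace ThreeShrinker

variable (N : Type*) [TopologicalSpace N] [T2Space N]
  [ChartedSpace (EuclideanSpace ℝ (Fin 3)) N] [IsManifold (𝓡 3) ∞ N] [CompactSpace N]
  [ConnectedSpace N] [MeasurableSpace N] [BorelSpace N] [T3Space N]
  (g : PseudoRiemannianMetric (𝓡 3) ∞ (EuclideanSpace ℝ (Fin 3))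
    (TangentSpace (𝓡 3) : N → Type _)) [g.HasLeviCivita] (hg : g.IsRiemannian)

/-- **Disjunct (a) of `threeShrinkerClassification_modelData` for compact Einstein members.** In
the fact's binder with `N` compact and `Ric = λ h` for some constant `λ`: `h` has constant sectional
curvature `λ/2` (`hasConstantSectionalCurvature_of_ricci_eq_three`, Lee 2018, Problem 8-14), so
`ThreeShrinkerSphericalCase.modelData_a_of_constantCurvature` applies:
`CompactSpace N ∧ R ≡ 3/2 ∧ φ ≡ 3/2 ∧ ∃ k ≥ 1, Vol(N) = 16π²/k`.
[cite: MunteanuWang2016, Thm 1.2 (p. 3); proof of Thm 5.1 (p. 21)] [cite: Ivey1993, Thm 1]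
[cite: Lee2018, Problem 8-14] -/
theorem modelData_a_of_ricci_eq_smul (φ : N → ℝ) (hφ : ContMDiff (𝓡 3) 𝓘(ℝ, ℝ) ∞ φ)
    (hsol : ∀ (x : N) (X Y : TangentSpace (𝓡 3) x),
      g.ricci x X Y + g.hessian φ x X Y = (1 / 2 : ℝ) * g.val x X Y)
    (hnorm : ∀ x : N, g.scalarCurvature x + g.gradSq φ x = φ x)
    {lam : ℝ} (hRic : ∀ (x : N) (X Y : TangentSpace (𝓡 3) x), g.ricci x X Y = lam * g.val x X Y) :
    CompactSpace N ∧ (∀ x : N, g.scalarCurvature x = 3 / 2) ∧ (∀ x : N, φ x = 3 / 2) ∧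
      ∃ k : ℕ, 0 < k ∧
        riemannianMeasure (g.toContMDiffRiemannianMetric hg) Set.univ =
          ENNReal.ofReal (16 * Real.pi ^ 2 / k) := by
  have h3 : finrank ℝ (EuclideanSpace ℝ (Fin 3)) = 3 := finrank_euclideanSpace_fin
  have h2 : (2 : ℕ∞ω) ≤ ((⊤ : ℕ∞) : ℕ∞ω) := WithTop.coe_le_coe.mpr le_top
  have hK : g.HasConstantSectionalCurvature (lam / 2) :=
    hasConstantSectionalCurvature_of_ricci_eq_three g h2 hg h3 hRic
  exact modelData_a_of_constantCurvature N g hg φ hφ hsol hnorm hK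

/-- **Disjunct (a) for compact members with `Hess φ ≡ 0`**: then the soliton equation reads
`Ric = ½ h`, an Einstein metric. [cite: MunteanuWang2016, Thm 1.2 (p. 3)]
[cite: CarrilloNi2009, Rem. 4.2] -/
theorem modelData_a_of_hessian_eq_zero (φ : N → ℝ) (hφ : ContMDiff (𝓡 3) 𝓘(ℝ, ℝ) ∞ φ)
    (hsol : ∀ (x : N) (X Y : TangentSpace (𝓡 3) x),
      g.ricci x X Y + g.hessian φ x X Y = (1 / 2 : ℝ) * g.val x X Y)
    (hnorm : ∀ x : N, g.scalarCurvature x + g.gradSq φ x = φ x)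
    (hHess : ∀ (x : N) (X Y : TangentSpace (𝓡 3) x), g.hessian φ x X Y = 0) :
    CompactSpace N ∧ (∀ x : N, g.scalarCurvature x = 3 / 2) ∧ (∀ x : N, φ x = 3 / 2) ∧
      ∃ k : ℕ, 0 < k ∧
        riemannianMeasure (g.toContMDiffRiemannianMetric hg) Set.univ =
          ENNReal.ofReal (16 * Real.pi ^ 2 / k) := by
  refine modelData_a_of_ricci_eq_smul N g hg φ hφ hsol hnorm (lam := 1 / 2) fun x X Y ↦ ?_
  have h := hsol x X Y
  rw [hHess x X Y, add_zero] at h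
  exact h

omit [T2Space N] [CompactSpace N] [ConnectedSpace N] [MeasurableSpace N] [BorelSpace N]
  [T3Space N] in
/-- The Hessian of a constant potential vanishes (`mvfderiv` of a constant is `0`; O'Neill 1983,
Ch. 3, Def. 3.48). [cite: ONeill1983, Ch. 3, Def. 3.48] -/
theorem hessian_apply_eq_zero_of_eq_const {φ : N → ℝ} {c : ℝ} (hc : ∀ x, φ x = c) (x : N)
    (X Y : TangentSpace (𝓡 3) x) : g.hessian φ x X Y = 0 := by
  obtain rfl : φ = fun _ ↦ c := funext hc
  have haux : ∀ X Y : Π x : N, TangentSpace (𝓡 3) x,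
      g.hessianAux (fun _ ↦ c) X Y x = 0 := by
    intro X Y
    simp [PseudoRiemannianMetric.hessianAux, mvfderiv_const]
  have hzero : g.hessian (fun _ : N ↦ c) x = 0 := by
    unfold PseudoRiemannianMetric.hessian
    have hex : ∃ B : LinearMap.BilinForm ℝ (TangentSpace (𝓡 3) x),
        ∀ X₀ Y₀ : TangentSpace (𝓡 3) x,
          B X₀ Y₀ = g.hessianAux (fun _ ↦ c) (FiberBundle.extend (EuclideanSpace ℝ (Fin 3)) X₀)
            (FiberBundle.extend (EuclideanSpace ℝ (Fin 3)) Y₀) x :=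
      ⟨0, fun _ _ ↦ by simp [haux]⟩
    rw [dif_pos hex]
    ext X₀ Y₀
    simpa [haux] using hex.choose_spec X₀ Y₀
  rw [hzero]
  rfl

/-- **Disjunct (a) for compact members with constant potential** (`φ ≡ c`; then `Hess φ = 0`,
`Ric = ½ h`; Carrillo–Ni 2009, Rem. 4.2: "when `f` = constant, `(M, g)` is an Einstein manifold
with `Ric_M = ½ g_M`"). [cite: MunteanuWang2016, Thm 1.2 (p. 3)] [cite: CarrilloNi2009, Rem. 4.2] -/
theorem modelData_a_of_potential_eq_const (φ : N → ℝ) (hφ : ContMDiff (𝓡 3) 𝓘(ℝ, ℝ) ∞ φ)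
    (hsol : ∀ (x : N) (X Y : TangentSpace (𝓡 3) x),
      g.ricci x X Y + g.hessian φ x X Y = (1 / 2 : ℝ) * g.val x X Y)
    (hnorm : ∀ x : N, g.scalarCurvature x + g.gradSq φ x = φ x)
    {c : ℝ} (hc : ∀ x, φ x = c) :
    CompactSpace N ∧ (∀ x : N, g.scalarCurvature x = 3 / 2) ∧ (∀ x : N, φ x = 3 / 2) ∧
      ∃ k : ℕ, 0 < k ∧
        riemannianMeasure (g.toContMDiffRiemannianMetric hg) Set.univ =
          ENNReal.ofReal (16 * Real.pi ^ 2 / k) :=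
  modelData_a_of_hessian_eq_zero N g hg φ hφ hsol hnorm
    (hessian_apply_eq_zero_of_eq_const N g hc)

/-- **The conclusion of `threeShrinkerClassification_modelData` for compact Einstein members of
its binder** (its four-way disjunction, by the second disjunct). What remains for the compact half
of the fact is the theorem that compact three-dimensional shrinking solitons are Einstein
(Ivey 1993, Thm. 1). [cite: MunteanuWang2016, Thm 1.2 (p. 3)] [cite: Ivey1993, Thm 1] -/
theorem modelData_of_ricci_eq_smul (φ : N → ℝ) (hφ : ContMDiff (𝓡 3) 𝓘(ℝ, ℝ) ∞ φ)
    (hsol : ∀ (x : N) (X Y : TangentSpace (𝓡 3) x),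
      g.ricci x X Y + g.hessian φ x X Y = (1 / 2 : ℝ) * g.val x X Y)
    (hnorm : ∀ x : N, g.scalarCurvature x + g.gradSq φ x = φ x)
    {lam : ℝ} (hRic : ∀ (x : N) (X Y : TangentSpace (𝓡 3) x), g.ricci x X Y = lam * g.val x X Y) :
    ((∀ x : N, g.scalarCurvature x = 0) ∧
        ∫⁻ x, ENNReal.ofReal (Real.exp (-φ x))
            ∂(riemannianMeasure (g.toContMDiffRiemannianMetric hg)) =
          ENNReal.ofReal (8 * Real.pi * Real.sqrt Real.pi)) ∨
    (CompactSpace N ∧ (∀ x : N, g.scalarCurvature x = 3 / 2) ∧ (∀ x : N, φ x = 3 / 2) ∧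
        ∃ k : ℕ, 0 < k ∧
          riemannianMeasure (g.toContMDiffRiemannianMetric hg) Set.univ =
            ENNReal.ofReal (16 * Real.pi ^ 2 / k)) ∨
    ((∀ x : N, g.scalarCurvature x = 1) ∧
        ∫⁻ x, ENNReal.ofReal (Real.exp (-φ x))
            ∂(riemannianMeasure (g.toContMDiffRiemannianMetric hg)) =
          ENNReal.ofReal (16 * Real.pi * Real.sqrt Real.pi * Real.exp (-1))) ∨
    ((∀ x : N, g.scalarCurvature x = 1) ∧
        ∫⁻ x, ENNReal.ofReal (Real.exp (-φ x))
            ∂(riemannianMeasure (g.toContMDiffRiemannianMetric hg)) =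
          ENNReal.ofReal (8 * Real.pi * Real.sqrt Real.pi * Real.exp (-1))) :=
  Or.inr (Or.inl (modelData_a_of_ricci_eq_smul N g hg φ hφ hsol hnorm hRic))

end ThreeShrinker

end Literature.Geometry.Riemannian

end
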